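import Mathlib
import Summits.ValiantsHypothesis.ValiantsHypothesis.Theorems.ElementaryWordLengthWordLengthQPStubKappaTwoStructureAux

/-!
# Crux `WordLengthQP` (stmt-ValiantsHypothesis-6623), line `positive-monoid-exits` —
helpers for stub `stub_kappaTwoStructure`, part B: at most one wild letter, the conjugated
identity for two wild letters, and the shape of confined tame stretches.

* `k2_le_one_wild_absurd`: a word with at most one wild letter (exit with nonzero coefficient)
  never computes `E₀₂(F)` when `F ≥ 0` has a monomial of degree `≥ 2` (rung-1 argument).
* `k2_two_wild_identity`: `w = P₀ ℓ₁ Q ℓ₂ P₂ = E` gives `(Sℓ₁S)(SQS)(Sℓ₂S) = P₀ʳᵉᵛ E P₂ʳᵉᵛ`.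
* `k2_no_letter`, `k2_col2_trivial`, `k2_row0_trivial`, `k2_upper_shape`: a tame stretch whose
  product has a vanishing adjacent entry has no letter of that type, and then its product is
  confined (column `2` trivial / row `0` trivial / upper unitriangular of low degree).
-/

set_option linter.dupNamespace false

noncomputable section

namespace Summit.ValiantsHypothesis.ValiantsHypothesis.Cruxes.WordLengthQP.PositiveMonoidExits

open MvPolynomial

/-! ## At most one wild letter -/

/-- Isolation (in a monoid, `S² = 1`): if `(∏ Ts₀) T (∏ Ts₁) = E` with `U S U = S` for every `U` in
`Ts₀`, `Ts₁`, then `S T S = (∏ Ts₀.reverse) (S E S) (∏ Ts₁.reverse)`.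
(adapted from …StubKappaGeTwo.lean) [folklore] -/
theorem k2_isolate {M : Type*} [Monoid M] (S : M) (hSS : S * S = 1) (Ts0 Ts1 : List M)
    (T E : M) (h0 : ∀ U ∈ Ts0, U * S * U = S) (h1 : ∀ U ∈ Ts1, U * S * U = S)
    (h : Ts0.prod * (T * Ts1.prod) = E) :
    S * T * S = Ts0.reverse.prod * (S * E * S) * Ts1.reverse.prod := by
  obtain ⟨-, hA0⟩ := k2_prod_mul_S_mul_rev S Ts0 h0
  obtain ⟨hA1, -⟩ := k2_prod_mul_S_mul_rev S Ts1 h1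
  have hL : S * Ts0.reverse.prod * S * Ts0.prod = 1 := by
    calc S * Ts0.reverse.prod * S * Ts0.prod
        = S * (Ts0.reverse.prod * S * Ts0.prod) := by simp only [mul_assoc]
      _ = 1 := by rw [hA0, hSS]
  have hR : Ts1.prod * S * Ts1.reverse.prod * S = 1 := by rw [hA1, hSS]
  calc S * T * S
      = S * ((S * Ts0.reverse.prod * S * Ts0.prod) * T *
          (Ts1.prod * S * Ts1.reverse.prod * S)) * S := by rw [hL, hR, one_mul, mul_one]
    _ = (S * S) * Ts0.reverse.prod * (S * (Ts0.prod * (T * Ts1.prod)) * S) *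
          Ts1.reverse.prod * (S * S) := by simp only [mul_assoc]
    _ = Ts0.reverse.prod * (S * E * S) * Ts1.reverse.prod := by rw [h, hSS, one_mul, mul_one]

/-- The reversed matrix list of a tame stretch is `1 +` (coefficientwise nonnegative). [folklore] -/
theorem k2_rev_sub_one_nonneg {σ : Type} (p : List (Fin 3 × Fin 3 × ℝ × Option σ))
    (hp : ∀ l ∈ p, ((0 < Prod.fst (Prod.snd (Prod.snd l)) ∧ (Fin.val (Prod.fst l) + 1 = Fin.val (Prod.fst (Prod.snd l)) ∨ Fin.val (Prod.fst (Prod.snd l)) + 1 = Fin.val (Prod.fst l))) ∨ Prod.fst (Prod.snd (Prod.snd l)) = 0)) :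
    ∀ i j m, 0 ≤ (((p.map (fun l => (Matrix.transvection (Prod.fst l) (Prod.fst (Prod.snd l)) (MvPolynomial.C (Prod.fst (Prod.snd (Prod.snd l))) * Option.elim (Prod.snd (Prod.snd (Prod.snd l))) 1 MvPolynomial.X) : Matrix (Fin 3) (Fin 3) (MvPolynomial σ ℝ)))).reverse.prod - 1) i j).coeff m := by
  refine k2_prod_sub_one_nonneg _ fun T hT => ?_
  rw [List.mem_reverse, List.mem_map] at hT
  obtain ⟨l, hl, rfl⟩ := hT
  exact k2_tame_sub_one_nonneg l (hp l hl)

/-- **At most one wild letter is absurd** (rung-1 argument for a general target): if `F` has a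
monomial `m₀` of degree `≥ 2` with positive coefficient and `F ≥ 0` coefficientwise, no word with
at most one wild letter computes `E₀₂(F)`: isolating the wild letter `L`,
`S L S = P₀ʳᵉᵛ E₀₂(F) P₁ʳᵉᵛ ≥ E₀₂(F)` coefficientwise, but `(S L S)₀₂` has total degree `≤ 1`.
[folklore] -/
theorem k2_le_one_wild_absurd {σ : Type} (F : MvPolynomial σ ℝ) (hpos : ∀ m, 0 ≤ F.coeff m)
    (m₀ : σ →₀ ℕ) (hm₀ : 2 ≤ m₀.degree) (hFm₀ : 0 < F.coeff m₀)
    (w : List (Fin 3 × Fin 3 × ℝ × Option σ)) (hw1 : (w.filter (fun l => decide (¬ (0 < Prod.fst (Prod.snd (Prod.snd l)) ∧ (Fin.val (Prod.fst l) + 1 = Fin.val (Prod.fst (Prod.snd l)) ∨ Fin.val (Prod.fst (Prod.snd l)) + 1 = Fin.val (Prod.fst l))) ∧ Prod.fst (Prod.snd (Prod.snd l)) ≠ 0))).length ≤ 1)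
    (hF : (w.map (fun l => (Matrix.transvection (Prod.fst l) (Prod.fst (Prod.snd l)) (MvPolynomial.C (Prod.fst (Prod.snd (Prod.snd l))) * Option.elim (Prod.snd (Prod.snd (Prod.snd l))) 1 MvPolynomial.X) : Matrix (Fin 3) (Fin 3) (MvPolynomial σ ℝ)))).prod = Matrix.transvection (0 : Fin 3) 2 F) : False := by
  have hE02 : ((Matrix.transvection (0 : Fin 3) 2 F) 0 2).coeff m₀ = F.coeff m₀ := by
    simp [Matrix.transvection]
  rcases k2_split1 _ w hw1 with rfl | ⟨p0, L, p1, rfl, hp0, hp1⟩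
  · rw [List.map_nil, List.prod_nil] at hF
    have h := congrArg (fun N : Matrix (Fin 3) (Fin 3) (MvPolynomial σ ℝ) => (N 0 2).coeff m₀) hF
    simp only [hE02, Matrix.one_apply_ne (show (0 : Fin 3) ≠ 2 by decide),
      MvPolynomial.coeff_zero] at h
    linarith
  · simp only [List.map_append, List.map_cons, List.prod_append, List.prod_cons] at hF
    have hB := k2_isolate (Matrix.diagonal ![(1 : MvPolynomial σ ℝ), -1, 1]) k2_S_mul_S _ _ _ _ (fun U hU => ?_) (fun U hU => ?_) hF
    rotate_left
    · obtain ⟨l, hl, rfl⟩ := List.mem_map.1 hU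
      exact k2_tame_mul_S_mul l (k2_tame_cases l (hp0 l hl))
    · obtain ⟨l, hl, rfl⟩ := List.mem_map.1 hU
      exact k2_tame_mul_S_mul l (k2_tame_cases l (hp1 l hl))
    rw [k2_S_mul_far_mul_S] at hB
    have key := congrArg (fun N : Matrix (Fin 3) (Fin 3) (MvPolynomial σ ℝ) => (N 0 2).coeff m₀) hB
    simp only [k2_S_T_S] at key
    -- left-hand side: total degree ≤ 1
    have hL0 : ((Matrix.transvection L.1 L.2.1
        (if L.1.val + 1 = L.2.1.val ∨ L.2.1.val + 1 = L.1.val then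
          -(C L.2.2.1 * L.2.2.2.elim 1 X) else C L.2.2.1 * L.2.2.2.elim 1 X) :
          Matrix (Fin 3) (Fin 3) (MvPolynomial σ ℝ)) 0 2).coeff m₀ = 0 := by
      rw [Matrix.transvection, Matrix.add_apply, Matrix.one_apply_ne (show (0 : Fin 3) ≠ 2 by decide),
        zero_add, Matrix.single_apply]
      split_ifs
      · refine MvPolynomial.coeff_eq_zero_of_totalDegree_lt ?_
        rw [MvPolynomial.totalDegree_neg]
        exact (k2_totalDegree_Cu _ _).trans_lt hm₀
      · refine MvPolynomial.coeff_eq_zero_of_totalDegree_lt ?_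
        exact (k2_totalDegree_Cu _ _).trans_lt hm₀
      · exact MvPolynomial.coeff_zero _
    -- right-hand side: ≥ F.coeff m₀
    have hR1 : F.coeff m₀ ≤ ((((p0.map (fun l => (Matrix.transvection (Prod.fst l) (Prod.fst (Prod.snd l)) (MvPolynomial.C (Prod.fst (Prod.snd (Prod.snd l))) * Option.elim (Prod.snd (Prod.snd (Prod.snd l))) 1 MvPolynomial.X) : Matrix (Fin 3) (Fin 3) (MvPolynomial σ ℝ)))).reverse.prod *
        Matrix.transvection (0 : Fin 3) 2 F * (p1.map (fun l => (Matrix.transvection (Prod.fst l) (Prod.fst (Prod.snd l)) (MvPolynomial.C (Prod.fst (Prod.snd (Prod.snd l))) * Option.elim (Prod.snd (Prod.snd (Prod.snd l))) 1 MvPolynomial.X) : Matrix (Fin 3) (Fin 3) (MvPolynomial σ ℝ)))).reverse.prod :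
          Matrix (Fin 3) (Fin 3) (MvPolynomial σ ℝ))) 0 2).coeff m₀ := by
      rw [← hE02]
      exact k2_coeff_le_conj _ _ _ (k2_rev_sub_one_nonneg p0 fun l hl => k2_tame_cases l (hp0 l hl))
        (k2_far_nonneg F hpos) (k2_rev_sub_one_nonneg p1 fun l hl => k2_tame_cases l (hp1 l hl)) 0 2 m₀
    rw [hL0] at key
    linarith

/-! ## Two wild letters: the conjugated identity and the placement -/

/-- With exactly two wild letters, `w = P₀ ℓ₁ Q ℓ₂ P₂ = E` (`S E S = E`) gives
`(S ℓ₁ S)(S Q S)(S ℓ₂ S) = P₀ʳᵉᵛ E P₂ʳᵉᵛ`. [folklore] -/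
theorem k2_two_wild_identity {M : Type*} [Monoid M] (S : M) (hSS : S * S = 1)
    (P0 Q P2 : List M) (L1 L2 E : M) (hE : S * E * S = E)
    (h0 : ∀ U ∈ P0, U * S * U = S) (h2 : ∀ U ∈ P2, U * S * U = S)
    (h : P0.prod * (L1 * (Q.prod * (L2 * P2.prod))) = E) :
    S * L1 * S * (S * Q.prod * S) * (S * L2 * S) = P0.reverse.prod * E * P2.reverse.prod := by
  have h' : P0.prod * (L1 * Q.prod * L2 * P2.prod) = E := by simpa only [mul_assoc] using h
  have hI := k2_isolate S hSS P0 P2 (L1 * Q.prod * L2) E h0 h2 h'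
  rw [hE] at hI
  calc S * L1 * S * (S * Q.prod * S) * (S * L2 * S)
      = S * L1 * (S * S) * Q.prod * (S * S) * L2 * S := by simp only [mul_assoc]
    _ = S * (L1 * Q.prod * L2) * S := by rw [hSS]; simp only [mul_assoc, one_mul]
    _ = P0.reverse.prod * E * P2.reverse.prod := hI

/-- Entry formula: `(E_{i₁j₁}(a) X E_{i₂j₂}(b))₀₂`. [folklore] -/
theorem k2_TXT_apply02 {R : Type*} [CommRing R] (i₁ j₁ i₂ j₂ : Fin 3) (a b : R)
    (X : Matrix (Fin 3) (Fin 3) R) :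
    (Matrix.transvection i₁ j₁ a * X * Matrix.transvection i₂ j₂ b) 0 2 =
      X 0 2 + (if i₁ = 0 then a * X j₁ 2 else 0) + (if j₂ = 2 then b * X 0 i₂ else 0) +
        (if i₁ = 0 ∧ j₂ = 2 then a * b * X j₁ i₂ else 0) := by
  by_cases h1 : i₁ = 0 <;> by_cases h2 : j₂ = 2
  · subst h1; subst h2
    rw [Matrix.mul_transvection_apply_same, Matrix.transvection_mul_apply_same,
      Matrix.transvection_mul_apply_same]
    simp only [if_true, and_self]; ring
  · subst h1
    rw [Matrix.mul_transvection_apply_of_ne _ _ _ _ (Ne.symm h2), Matrix.transvection_mul_apply_same]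
    simp [h2]
  · subst h2
    rw [Matrix.mul_transvection_apply_same, Matrix.transvection_mul_apply_of_ne _ _ _ _ (Ne.symm h1),
      Matrix.transvection_mul_apply_of_ne _ _ _ _ (Ne.symm h1)]
    simp [h1]
  · rw [Matrix.mul_transvection_apply_of_ne _ _ _ _ (Ne.symm h2),
      Matrix.transvection_mul_apply_of_ne _ _ _ _ (Ne.symm h1)]
    simp [h1, h2]

/-- In a tame stretch whose product has coefficientwise-nonpositive `(i, j)` entry (`i ≠ j`),
every letter of type `(i, j)` has coefficient `0`. [folklore] -/
theorem k2_no_letter {σ : Type} (q : List (Fin 3 × Fin 3 × ℝ × Option σ))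
    (hq : ∀ l ∈ q, ((0 < Prod.fst (Prod.snd (Prod.snd l)) ∧ (Fin.val (Prod.fst l) + 1 = Fin.val (Prod.fst (Prod.snd l)) ∨ Fin.val (Prod.fst (Prod.snd l)) + 1 = Fin.val (Prod.fst l))) ∨ Prod.fst (Prod.snd (Prod.snd l)) = 0)) (i j : Fin 3) (hij : i ≠ j)
    (hle : ∀ m, (((q.map (fun l => (Matrix.transvection (Prod.fst l) (Prod.fst (Prod.snd l)) (MvPolynomial.C (Prod.fst (Prod.snd (Prod.snd l))) * Option.elim (Prod.snd (Prod.snd (Prod.snd l))) 1 MvPolynomial.X) : Matrix (Fin 3) (Fin 3) (MvPolynomial σ ℝ)))).prod) i j).coeff m ≤ 0) :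
    ∀ l ∈ q, l.1 = i → l.2.1 = j → l.2.2.1 = 0 := by
  classical
  intro l hl hi hj
  rcases (hq l hl) with ⟨hc, -⟩ | h0
  · exfalso
    have hmem : (Matrix.transvection (Prod.fst l) (Prod.fst (Prod.snd l)) (MvPolynomial.C (Prod.fst (Prod.snd (Prod.snd l))) * Option.elim (Prod.snd (Prod.snd (Prod.snd l))) 1 MvPolynomial.X) : Matrix (Fin 3) (Fin 3) (MvPolynomial σ ℝ)) ∈ q.map (fun l => (Matrix.transvection (Prod.fst l) (Prod.fst (Prod.snd l)) (MvPolynomial.C (Prod.fst (Prod.snd (Prod.snd l))) * Option.elim (Prod.snd (Prod.snd (Prod.snd l))) 1 MvPolynomial.X) : Matrix (Fin 3) (Fin 3) (MvPolynomial σ ℝ))) := List.mem_map_of_mem hl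
    have key := k2_mem_le_prod_sub_one (q.map (fun l => (Matrix.transvection (Prod.fst l) (Prod.fst (Prod.snd l)) (MvPolynomial.C (Prod.fst (Prod.snd (Prod.snd l))) * Option.elim (Prod.snd (Prod.snd (Prod.snd l))) 1 MvPolynomial.X) : Matrix (Fin 3) (Fin 3) (MvPolynomial σ ℝ)))) (fun T hT => by
      obtain ⟨l', hl', rfl⟩ := List.mem_map.1 hT
      exact k2_tame_sub_one_nonneg l' (hq l' hl')) _ hmem i j
    -- the monomial carried by the letter
    set mu : σ →₀ ℕ := l.2.2.2.elim 0 (fun v => Finsupp.single v 1) with hmu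
    have hcoef : (((Matrix.transvection (Prod.fst l) (Prod.fst (Prod.snd l)) (MvPolynomial.C (Prod.fst (Prod.snd (Prod.snd l))) * Option.elim (Prod.snd (Prod.snd (Prod.snd l))) 1 MvPolynomial.X) : Matrix (Fin 3) (Fin 3) (MvPolynomial σ ℝ)) - 1) i j).coeff mu = l.2.2.1 := by
      subst hi; subst hj
      rw [k2_letter_sub_one_apply_self l, MvPolynomial.coeff_C_mul, hmu]
      rcases l with ⟨a, b, c, _ | v⟩ <;> simp
    have h1 := key mu
    rw [hcoef, Matrix.sub_apply, MvPolynomial.coeff_sub, Matrix.one_apply_ne hij,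
      MvPolynomial.coeff_zero, sub_zero] at h1
    linarith [hle mu]
  · exact h0

/-- The type of a positive adjacent letter is one of the four adjacent pairs. [folklore] -/
theorem k2_adj_types {σ : Type} (l : Fin 3 × Fin 3 × ℝ × Option σ) (hadj : (Fin.val (Prod.fst l) + 1 = Fin.val (Prod.fst (Prod.snd l)) ∨ Fin.val (Prod.fst (Prod.snd l)) + 1 = Fin.val (Prod.fst l))) :
    (l.1 = 0 ∧ l.2.1 = 1) ∨ (l.1 = 1 ∧ l.2.1 = 2) ∨ (l.1 = 1 ∧ l.2.1 = 0) ∨ (l.1 = 2 ∧ l.2.1 = 1) := by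
  rcases l with ⟨a, b, c, o⟩
  fin_cases a <;> fin_cases b <;> simp at hadj ⊢

/-- Column `2` of a tame letter that is not a positive `x₂ = E₁₂` is `e₂`. [folklore] -/
theorem k2_letter_col2 {σ : Type} (l : Fin 3 × Fin 3 × ℝ × Option σ) (hq : ((0 < Prod.fst (Prod.snd (Prod.snd l)) ∧ (Fin.val (Prod.fst l) + 1 = Fin.val (Prod.fst (Prod.snd l)) ∨ Fin.val (Prod.fst (Prod.snd l)) + 1 = Fin.val (Prod.fst l))) ∨ Prod.fst (Prod.snd (Prod.snd l)) = 0))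
    (hx2 : l.1 = 1 → l.2.1 = 2 → l.2.2.1 = 0) (i : Fin 3) :
    (Matrix.transvection (Prod.fst l) (Prod.fst (Prod.snd l)) (MvPolynomial.C (Prod.fst (Prod.snd (Prod.snd l))) * Option.elim (Prod.snd (Prod.snd (Prod.snd l))) 1 MvPolynomial.X) : Matrix (Fin 3) (Fin 3) (MvPolynomial σ ℝ)) i 2 = if i = 2 then 1 else 0 := by
  rcases hq with ⟨-, hadj⟩ | h0
  · rcases k2_adj_types l hadj with ⟨h1, h2⟩ | ⟨h1, h2⟩ | ⟨h1, h2⟩ | ⟨h1, h2⟩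
    · rw [h1, h2]; fin_cases i <;> simp [Matrix.transvection]
    · have := hx2 h1 h2
      rw [this]; fin_cases i <;> simp
    · rw [h1, h2]; fin_cases i <;> simp [Matrix.transvection]
    · rw [h1, h2]; fin_cases i <;> simp [Matrix.transvection]
  · rw [h0]; fin_cases i <;> simp

/-- Row `0` of a tame letter that is not a positive `x₁ = E₀₁` is `e₀`. [folklore] -/
theorem k2_letter_row0 {σ : Type} (l : Fin 3 × Fin 3 × ℝ × Option σ) (hq : ((0 < Prod.fst (Prod.snd (Prod.snd l)) ∧ (Fin.val (Prod.fst l) + 1 = Fin.val (Prod.fst (Prod.snd l)) ∨ Fin.val (Prod.fst (Prod.snd l)) + 1 = Fin.val (Prod.fst l))) ∨ Prod.fst (Prod.snd (Prod.snd l)) = 0))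
    (hx1 : l.1 = 0 → l.2.1 = 1 → l.2.2.1 = 0) (j : Fin 3) :
    (Matrix.transvection (Prod.fst l) (Prod.fst (Prod.snd l)) (MvPolynomial.C (Prod.fst (Prod.snd (Prod.snd l))) * Option.elim (Prod.snd (Prod.snd (Prod.snd l))) 1 MvPolynomial.X) : Matrix (Fin 3) (Fin 3) (MvPolynomial σ ℝ)) 0 j = if j = 0 then 1 else 0 := by
  rcases hq with ⟨-, hadj⟩ | h0
  · rcases k2_adj_types l hadj with ⟨h1, h2⟩ | ⟨h1, h2⟩ | ⟨h1, h2⟩ | ⟨h1, h2⟩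
    · have := hx1 h1 h2
      rw [this]; fin_cases j <;> simp
    · rw [h1, h2]; fin_cases j <;> simp [Matrix.transvection]
    · rw [h1, h2]; fin_cases j <;> simp [Matrix.transvection]
    · rw [h1, h2]; fin_cases j <;> simp [Matrix.transvection]
  · rw [h0]; fin_cases j <;> simp

/-- Column `2` of a tame stretch without positive `x₂ = E₁₂` letters is `e₂`. [folklore] -/
theorem k2_col2_trivial {σ : Type} (q : List (Fin 3 × Fin 3 × ℝ × Option σ))
    (hq : ∀ l ∈ q, ((0 < Prod.fst (Prod.snd (Prod.snd l)) ∧ (Fin.val (Prod.fst l) + 1 = Fin.val (Prod.fst (Prod.snd l)) ∨ Fin.val (Prod.fst (Prod.snd l)) + 1 = Fin.val (Prod.fst l))) ∨ Prod.fst (Prod.snd (Prod.snd l)) = 0)) (hx2 : ∀ l ∈ q, l.1 = 1 → l.2.1 = 2 → l.2.2.1 = 0) :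
    ∀ i, (q.map (fun l => (Matrix.transvection (Prod.fst l) (Prod.fst (Prod.snd l)) (MvPolynomial.C (Prod.fst (Prod.snd (Prod.snd l))) * Option.elim (Prod.snd (Prod.snd (Prod.snd l))) 1 MvPolynomial.X) : Matrix (Fin 3) (Fin 3) (MvPolynomial σ ℝ)))).prod i 2 = if i = 2 then 1 else 0 := by
  induction q with
  | nil => intro i; simp [Matrix.one_apply]
  | cons l q ih =>
    have ih' := ih (fun l' hl' => hq l' (by simp [hl'])) (fun l' hl' => hx2 l' (by simp [hl']))
    have hl := k2_letter_col2 l (hq l (by simp)) (hx2 l (by simp))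
    intro i
    rw [List.map_cons, List.prod_cons, Matrix.mul_apply, Fin.sum_univ_three, ih', ih', ih', hl]
    simp

/-- Row `0` of a tame stretch without positive `x₁ = E₀₁` letters is `e₀`. [folklore] -/
theorem k2_row0_trivial {σ : Type} (q : List (Fin 3 × Fin 3 × ℝ × Option σ))
    (hq : ∀ l ∈ q, ((0 < Prod.fst (Prod.snd (Prod.snd l)) ∧ (Fin.val (Prod.fst l) + 1 = Fin.val (Prod.fst (Prod.snd l)) ∨ Fin.val (Prod.fst (Prod.snd l)) + 1 = Fin.val (Prod.fst l))) ∨ Prod.fst (Prod.snd (Prod.snd l)) = 0)) (hx1 : ∀ l ∈ q, l.1 = 0 → l.2.1 = 1 → l.2.2.1 = 0) :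
    ∀ j, (q.map (fun l => (Matrix.transvection (Prod.fst l) (Prod.fst (Prod.snd l)) (MvPolynomial.C (Prod.fst (Prod.snd (Prod.snd l))) * Option.elim (Prod.snd (Prod.snd (Prod.snd l))) 1 MvPolynomial.X) : Matrix (Fin 3) (Fin 3) (MvPolynomial σ ℝ)))).prod 0 j = if j = 0 then 1 else 0 := by
  induction q with
  | nil => intro j; simp [Matrix.one_apply, eq_comm]
  | cons l q ih =>
    have ih' := ih (fun l' hl' => hq l' (by simp [hl'])) (fun l' hl' => hx1 l' (by simp [hl']))
    have hl := k2_letter_row0 l (hq l (by simp)) (hx1 l (by simp))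
    intro j
    rw [List.map_cons, List.prod_cons, Matrix.mul_apply, Fin.sum_univ_three, hl, hl, hl, ih']
    simp

/-- A tame stretch without positive `y₁ = E₁₀`, `y₂ = E₂₁` letters is upper unitriangular with
`(0,1)`, `(1,2)` entries of total degree `≤ 1` and `(0,2)` entry of total degree `≤ 2`. [folklore] -/
theorem k2_upper_shape {σ : Type} (q : List (Fin 3 × Fin 3 × ℝ × Option σ))
    (hq : ∀ l ∈ q, ((0 < Prod.fst (Prod.snd (Prod.snd l)) ∧ (Fin.val (Prod.fst l) + 1 = Fin.val (Prod.fst (Prod.snd l)) ∨ Fin.val (Prod.fst (Prod.snd l)) + 1 = Fin.val (Prod.fst l))) ∨ Prod.fst (Prod.snd (Prod.snd l)) = 0)) (hy1 : ∀ l ∈ q, l.1 = 1 → l.2.1 = 0 → l.2.2.1 = 0)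
    (hy2 : ∀ l ∈ q, l.1 = 2 → l.2.1 = 1 → l.2.2.1 = 0) :
    (q.map (fun l => (Matrix.transvection (Prod.fst l) (Prod.fst (Prod.snd l)) (MvPolynomial.C (Prod.fst (Prod.snd (Prod.snd l))) * Option.elim (Prod.snd (Prod.snd (Prod.snd l))) 1 MvPolynomial.X) : Matrix (Fin 3) (Fin 3) (MvPolynomial σ ℝ)))).prod 1 0 = 0 ∧ (q.map (fun l => (Matrix.transvection (Prod.fst l) (Prod.fst (Prod.snd l)) (MvPolynomial.C (Prod.fst (Prod.snd (Prod.snd l))) * Option.elim (Prod.snd (Prod.snd (Prod.snd l))) 1 MvPolynomial.X) : Matrix (Fin 3) (Fin 3) (MvPolynomial σ ℝ)))).prod 2 0 = 0 ∧ (q.map (fun l => (Matrix.transvection (Prod.fst l) (Prod.fst (Prod.snd l)) (MvPolynomial.C (Prod.fst (Prod.snd (Prod.snd l))) * Option.elim (Prod.snd (Prod.snd (Prod.snd l))) 1 MvPolynomial.X) : Matrix (Fin 3) (Fin 3) (MvPolynomial σ ℝ)))).prod 2 1 = 0 ∧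
    (q.map (fun l => (Matrix.transvection (Prod.fst l) (Prod.fst (Prod.snd l)) (MvPolynomial.C (Prod.fst (Prod.snd (Prod.snd l))) * Option.elim (Prod.snd (Prod.snd (Prod.snd l))) 1 MvPolynomial.X) : Matrix (Fin 3) (Fin 3) (MvPolynomial σ ℝ)))).prod 0 0 = 1 ∧ (q.map (fun l => (Matrix.transvection (Prod.fst l) (Prod.fst (Prod.snd l)) (MvPolynomial.C (Prod.fst (Prod.snd (Prod.snd l))) * Option.elim (Prod.snd (Prod.snd (Prod.snd l))) 1 MvPolynomial.X) : Matrix (Fin 3) (Fin 3) (MvPolynomial σ ℝ)))).prod 1 1 = 1 ∧ (q.map (fun l => (Matrix.transvection (Prod.fst l) (Prod.fst (Prod.snd l)) (MvPolynomial.C (Prod.fst (Prod.snd (Prod.snd l))) * Option.elim (Prod.snd (Prod.snd (Prod.snd l))) 1 MvPolynomial.X) : Matrix (Fin 3) (Fin 3) (MvPolynomial σ ℝ)))).prod 2 2 = 1 ∧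
    ((q.map (fun l => (Matrix.transvection (Prod.fst l) (Prod.fst (Prod.snd l)) (MvPolynomial.C (Prod.fst (Prod.snd (Prod.snd l))) * Option.elim (Prod.snd (Prod.snd (Prod.snd l))) 1 MvPolynomial.X) : Matrix (Fin 3) (Fin 3) (MvPolynomial σ ℝ)))).prod 0 1).totalDegree ≤ 1 ∧ ((q.map (fun l => (Matrix.transvection (Prod.fst l) (Prod.fst (Prod.snd l)) (MvPolynomial.C (Prod.fst (Prod.snd (Prod.snd l))) * Option.elim (Prod.snd (Prod.snd (Prod.snd l))) 1 MvPolynomial.X) : Matrix (Fin 3) (Fin 3) (MvPolynomial σ ℝ)))).prod 1 2).totalDegree ≤ 1 ∧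
    ((q.map (fun l => (Matrix.transvection (Prod.fst l) (Prod.fst (Prod.snd l)) (MvPolynomial.C (Prod.fst (Prod.snd (Prod.snd l))) * Option.elim (Prod.snd (Prod.snd (Prod.snd l))) 1 MvPolynomial.X) : Matrix (Fin 3) (Fin 3) (MvPolynomial σ ℝ)))).prod 0 2).totalDegree ≤ 2 := by
  classical
  induction q with
  | nil => simp
  | cons l q ih =>
    obtain ⟨h10, h20, h21, h00, h11, h22, d01, d12, d02⟩ :=
      ih (fun l' hl' => hq l' (by simp [hl'])) (fun l' hl' => hy1 l' (by simp [hl']))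
        (fun l' hl' => hy2 l' (by simp [hl']))
    rw [List.map_cons, List.prod_cons]
    set Q := (q.map (fun l => (Matrix.transvection (Prod.fst l) (Prod.fst (Prod.snd l)) (MvPolynomial.C (Prod.fst (Prod.snd (Prod.snd l))) * Option.elim (Prod.snd (Prod.snd (Prod.snd l))) 1 MvPolynomial.X) : Matrix (Fin 3) (Fin 3) (MvPolynomial σ ℝ)))).prod with hQ
    -- the letter is `1`, `x₁(a)` or `x₂(a)` with `a` of total degree ≤ 1
    have hl : (Matrix.transvection (Prod.fst l) (Prod.fst (Prod.snd l)) (MvPolynomial.C (Prod.fst (Prod.snd (Prod.snd l))) * Option.elim (Prod.snd (Prod.snd (Prod.snd l))) 1 MvPolynomial.X) : Matrix (Fin 3) (Fin 3) (MvPolynomial σ ℝ)) = 1 ∨ (∃ a : MvPolynomial σ ℝ, a.totalDegree ≤ 1 ∧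
        ((Matrix.transvection (Prod.fst l) (Prod.fst (Prod.snd l)) (MvPolynomial.C (Prod.fst (Prod.snd (Prod.snd l))) * Option.elim (Prod.snd (Prod.snd (Prod.snd l))) 1 MvPolynomial.X) : Matrix (Fin 3) (Fin 3) (MvPolynomial σ ℝ)) = Matrix.transvection 0 1 a ∨ (Matrix.transvection (Prod.fst l) (Prod.fst (Prod.snd l)) (MvPolynomial.C (Prod.fst (Prod.snd (Prod.snd l))) * Option.elim (Prod.snd (Prod.snd (Prod.snd l))) 1 MvPolynomial.X) : Matrix (Fin 3) (Fin 3) (MvPolynomial σ ℝ)) = Matrix.transvection 1 2 a)) := by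
      rcases (hq l (by simp)) with ⟨hc, hadj⟩ | h0
      · rcases k2_adj_types l hadj with ⟨h1, h2⟩ | ⟨h1, h2⟩ | ⟨h1, h2⟩ | ⟨h1, h2⟩
        · exact Or.inr ⟨_, k2_totalDegree_Cu l.2.2.1 l.2.2.2, Or.inl (by simp [h1, h2])⟩
        · exact Or.inr ⟨_, k2_totalDegree_Cu l.2.2.1 l.2.2.2, Or.inr (by simp [h1, h2])⟩
        · exact Or.inl (by simp [hy1 l (by simp) h1 h2])
        · exact Or.inl (by simp [hy2 l (by simp) h1 h2])
      · exact Or.inl (by simp [h0])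
    rcases hl with h1 | ⟨a, ha, h1 | h1⟩ <;> rw [h1]
    · simpa [hQ] using And.intro h10 (And.intro h20 (And.intro h21 (And.intro h00 (And.intro h11
        (And.intro h22 (And.intro d01 (And.intro d12 d02)))))))
    · -- x₁(a): row 0 += a * row 1
      have r0 : ∀ k, (Matrix.transvection (0 : Fin 3) 1 a * Q) 0 k = Q 0 k + a * Q 1 k := fun k =>
        Matrix.transvection_mul_apply_same _ _ _ _ _
      have r1 : ∀ k, (Matrix.transvection (0 : Fin 3) 1 a * Q) 1 k = Q 1 k := fun k =>
        Matrix.transvection_mul_apply_of_ne _ _ _ _ (by decide) _ _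
      have r2 : ∀ k, (Matrix.transvection (0 : Fin 3) 1 a * Q) 2 k = Q 2 k := fun k =>
        Matrix.transvection_mul_apply_of_ne _ _ _ _ (by decide) _ _
      refine ⟨by rw [r1, h10], by rw [r2, h20], by rw [r2, h21], by rw [r0, h00, h10]; ring,
        by rw [r1, h11], by rw [r2, h22], ?_, by rw [r1]; exact d12, ?_⟩
      · rw [r0, h11, mul_one]
        exact (MvPolynomial.totalDegree_add _ _).trans (max_le d01 ha)
      · rw [r0]
        refine (MvPolynomial.totalDegree_add _ _).trans (max_le d02 ?_)
        refine (MvPolynomial.totalDegree_mul _ _).trans ?_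
        omega
    · -- x₂(a): row 1 += a * row 2
      have r1 : ∀ k, (Matrix.transvection (1 : Fin 3) 2 a * Q) 1 k = Q 1 k + a * Q 2 k := fun k =>
        Matrix.transvection_mul_apply_same _ _ _ _ _
      have r0 : ∀ k, (Matrix.transvection (1 : Fin 3) 2 a * Q) 0 k = Q 0 k := fun k =>
        Matrix.transvection_mul_apply_of_ne _ _ _ _ (by decide) _ _
      have r2 : ∀ k, (Matrix.transvection (1 : Fin 3) 2 a * Q) 2 k = Q 2 k := fun k =>
        Matrix.transvection_mul_apply_of_ne _ _ _ _ (by decide) _ _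
      refine ⟨by rw [r1, h10, h20]; ring, by rw [r2, h20], by rw [r2, h21], by rw [r0, h00],
        by rw [r1, h11, h21]; ring, by rw [r2, h22], by rw [r0]; exact d01, ?_, by rw [r0]; exact d02⟩
      rw [r1, h22, mul_one]
      exact (MvPolynomial.totalDegree_add _ _).trans (max_le d12 ha)

end Summit.ValiantsHypothesis.ValiantsHypothesis.Cruxes.WordLengthQP.PositiveMonoidExits

end
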